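import Mathlib
import Summits.NavierStokesRegularity.NavierStokesRegularity.Theorems.ThreadingFluxHorizonTowerZonalIsotropicAxis
import Summits.NavierStokesRegularity.NavierStokesRegularity.Theorems.ThreadingFluxHorizonTowerZonalBridge
import HarnessLib

/-!
# Crux `PoloidalLiouville` (stmt-NavierStokesRegularity-1222), crux idea «horizon-threading-tower» (ns-idea-15):
# NULL-CONE CHART CALCULUS — the loop bracket on the isotropic chart is a weighted Wronskian

Support file (`--supports stmt-NavierStokesRegularity-1222`, helper; cell `ns-wall-extremal`, width hand ns-wall-eng-3 g4; 0 kit).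

The isotropic chart `t ↦ ε(1,t) = (1 − t², i(1 + t²), 2t)` of the null cone `x·x = 0` of `ℂ³` (tree: `Zonal.isoVec`, `Zonal.chartT`,
file `ThreadingFluxHorizonTowerZonalIsotropicAxis`) turns a homogeneous polynomial `p` of degree `n` on `ℂ³` into the one-variable
polynomial `chartT p (t) = p(ε(1,t))` of degree `≤ 2n` (the de-homogenised binary form of `p|_{cone}`).  This file proves the calculus
of the chart that drives the FINITE-TOWER theorems of the line (`…FiniteTowerTopShell`, `…FiniteTowerDescent`):

* `derivative_chartT` (chain rule), `chartT_euler` (Euler's identity on the chart), `chartT_normSq_mul` (`chartT (r²·p) = 0`);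
* ★ `chartT_detP` — the WEIGHTED WRONSKIAN LAW: for `a ∈ 𝓟_m`, `b ∈ 𝓟_n`,
  `2i · chartT (det(∇a, ∇b, x)) = m · (chartT a) · (chartT b)′ − n · (chartT a)′ · (chartT b)`
  (the velocity `ε′ = (−2t, 2it, 2)` of the chart satisfies `ε × ε′ = 2i ε`, and `(A·ε)(B·ε′) − (A·ε′)(B·ε) = (A × B)·(ε × ε′)`);
* `natDegree_chartT_le` (`deg chartT p ≤ 2n`), `chartT_lin` / `exists_lin_chartT_eq` (the charts of the linear forms `⟪a,x⟫`,
  `a ∈ ℂ³`, are exactly the polynomials of degree `≤ 2`).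

HONEST LABEL: polynomial identities about one crux idea's typed objects; no Prop of the sketch is closed here; `HorizonTowerZonality`
(general towers), `PoloidalLiouville` (1222) OPEN; NS regularity NOT proved.  [folklore]
-/

-- the summit and its single sub-problem share the name (CONVENTIONS §1)
set_option linter.dupNamespace false

noncomputable section

open MvPolynomial Complex
open scoped Polynomial

namespace Summit.NavierStokesRegularity.NavierStokesRegularity.Theorems.PoloidalLiouville.HorizonTower.Zonal

/-! ### Algebra of the chart -/

/-- `chartT` is the substitution of the chart vector `ε(1,t) = (1 − t², i(1 + t²), 2t)`. [folklore] -/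
theorem chartT_eq_aeval (p : MvPolynomial (Fin 3) ℂ) :
    chartT p = aeval ![(1 : Polynomial ℂ) - Polynomial.X ^ 2, Polynomial.C I * (1 + Polynomial.X ^ 2), 2 * Polynomial.X] p :=
  rfl

/-- `chartT` is additive. [folklore] -/
theorem chartT_add (p q : MvPolynomial (Fin 3) ℂ) : chartT (p + q) = chartT p + chartT q := by
  simp [chartT_eq_aeval]

/-- `chartT` is multiplicative. [folklore] -/
theorem chartT_mul (p q : MvPolynomial (Fin 3) ℂ) : chartT (p * q) = chartT p * chartT q := by
  simp [chartT_eq_aeval]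

/-- `chartT` of a difference. [folklore] -/
theorem chartT_sub (p q : MvPolynomial (Fin 3) ℂ) : chartT (p - q) = chartT p - chartT q := by
  simp [chartT_eq_aeval]

/-- `chartT` of a negation. [folklore] -/
theorem chartT_neg (p : MvPolynomial (Fin 3) ℂ) : chartT (-p) = -chartT p := by
  simp [chartT_eq_aeval]

/-- `chartT` of a power. [folklore] -/
theorem chartT_pow (p : MvPolynomial (Fin 3) ℂ) (k : ℕ) : chartT (p ^ k) = chartT p ^ k := by
  simp [chartT_eq_aeval]

/-- `chartT` of a constant. [folklore] -/
@[simp] theorem chartT_C (c : ℂ) : chartT (C c) = Polynomial.C c := by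
  simp [chartT_eq_aeval, Polynomial.algebraMap_eq]

/-- `chartT` of zero. [folklore] -/
@[simp] theorem chartT_zero : chartT 0 = 0 := by simp [chartT_eq_aeval]

/-- `chartT` of a scalar multiple. [folklore] -/
theorem chartT_smul (c : ℂ) (p : MvPolynomial (Fin 3) ℂ) : chartT (c • p) = c • chartT p := by
  simp [chartT_eq_aeval]

/-- `chartT` of a natural multiple. [folklore] -/
theorem chartT_nsmul (k : ℕ) (p : MvPolynomial (Fin 3) ℂ) : chartT (k • p) = k • chartT p := by
  simp [chartT_eq_aeval]

/-- `chartT` of a finite sum. [folklore] -/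
theorem chartT_sum {ι : Type*} (s : Finset ι) (p : ι → MvPolynomial (Fin 3) ℂ) :
    chartT (∑ i ∈ s, p i) = ∑ i ∈ s, chartT (p i) := by
  simp [chartT_eq_aeval]

/-- The chart components: `chartT x₀ = 1 − t²`. [folklore] -/
@[simp] theorem chartT_X_zero : chartT (X 0 : MvPolynomial (Fin 3) ℂ) = 1 - Polynomial.X ^ 2 := by
  rw [chartT_eq_aeval, aeval_X]; rfl

/-- The chart components: `chartT x₁ = i(1 + t²)`. [folklore] -/
@[simp] theorem chartT_X_one : chartT (X 1 : MvPolynomial (Fin 3) ℂ) = Polynomial.C I * (1 + Polynomial.X ^ 2) := by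
  rw [chartT_eq_aeval, aeval_X]; rfl

/-- The chart components: `chartT x₂ = 2t`. [folklore] -/
@[simp] theorem chartT_X_two : chartT (X 2 : MvPolynomial (Fin 3) ℂ) = 2 * Polynomial.X := by
  rw [chartT_eq_aeval, aeval_X]; rfl

/-- The velocity of the chart, `ε′ = (−2t, 2it, 2)`: first component. [folklore] -/
@[simp] theorem derivative_chartT_X_zero :
    Polynomial.derivative (chartT (X 0 : MvPolynomial (Fin 3) ℂ)) = -(2 * Polynomial.X) := by
  simp only [chartT_X_zero, Polynomial.derivative_sub, Polynomial.derivative_one, Polynomial.derivative_X_sq,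
    Polynomial.C_ofNat, zero_sub]

/-- The velocity of the chart: second component. [folklore] -/
@[simp] theorem derivative_chartT_X_one :
    Polynomial.derivative (chartT (X 1 : MvPolynomial (Fin 3) ℂ)) = Polynomial.C I * (2 * Polynomial.X) := by
  simp only [chartT_X_one, Polynomial.derivative_mul, Polynomial.derivative_C, zero_mul, zero_add,
    Polynomial.derivative_add, Polynomial.derivative_one, Polynomial.derivative_X_sq, Polynomial.C_ofNat]

/-- The velocity of the chart: third component. [folklore] -/
@[simp] theorem derivative_chartT_X_two :
    Polynomial.derivative (chartT (X 2 : MvPolynomial (Fin 3) ℂ)) = 2 := by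
  simp only [chartT_X_two, Polynomial.derivative_mul, Polynomial.derivative_X, mul_one, Polynomial.derivative_ofNat,
    zero_mul, zero_add]

/-- `chartT 1 = 1`. [folklore] -/
@[simp] theorem chartT_one : chartT 1 = 1 := by simp [chartT_eq_aeval]

/-! ### Chain rule and Euler's identity on the chart -/

/-- **Chain rule on the chart**: `(chartT p)′ = Σⱼ chartT (∂ⱼ p) · ε′ⱼ`. [folklore] -/
theorem derivative_chartT (p : MvPolynomial (Fin 3) ℂ) :
    Polynomial.derivative (chartT p)
      = ∑ j : Fin 3, chartT (pderiv j p) * Polynomial.derivative (chartT (X j : MvPolynomial (Fin 3) ℂ)) := by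
  classical
  induction p using MvPolynomial.induction_on with
  | C a => simp
  | add p q hp hq =>
    simp only [chartT_add, map_add, hp, hq, add_mul, Finset.sum_add_distrib]
  | mul_X p i hp =>
    have hterm : ∀ j : Fin 3, chartT (pderiv j (p * X i)) * Polynomial.derivative (chartT (X j : MvPolynomial (Fin 3) ℂ))
        = chartT (pderiv j p) * Polynomial.derivative (chartT (X j : MvPolynomial (Fin 3) ℂ)) * chartT (X i)
          + (if j = i then chartT p * Polynomial.derivative (chartT (X i : MvPolynomial (Fin 3) ℂ)) else 0) := by
      intro j
      rw [(pderiv j).leibniz, smul_eq_mul, smul_eq_mul, chartT_add, chartT_mul, chartT_mul]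
      by_cases hji : j = i
      · subst hji
        rw [pderiv_X_self, if_pos rfl, chartT_one]; ring
      · rw [pderiv_X_of_ne (fun h => hji h.symm), chartT_zero, if_neg hji]; ring
    rw [chartT_mul, Polynomial.derivative_mul, hp, Finset.sum_congr rfl (fun j _ => hterm j), Finset.sum_add_distrib,
      Finset.sum_ite_eq' Finset.univ i, if_pos (Finset.mem_univ i), Finset.sum_mul]

/-- **Euler's identity on the chart**: `Σⱼ chartT (∂ⱼ p) · εⱼ = n · chartT p` for `p` homogeneous of degree `n`. [folklore] -/
theorem chartT_euler {p : MvPolynomial (Fin 3) ℂ} {n : ℕ} (hp : p.IsHomogeneous n) :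
    ∑ j : Fin 3, chartT (pderiv j p) * chartT (X j : MvPolynomial (Fin 3) ℂ) = (n : ℂ[X]) * chartT p := by
  have h := congrArg chartT hp.sum_X_mul_pderiv
  rw [chartT_sum, chartT_nsmul, nsmul_eq_mul] at h
  rw [← h]
  refine Finset.sum_congr rfl fun j _ => ?_
  rw [chartT_mul, mul_comm]

/-! ### The chart kills `r²` -/

/-- The chart vector is isotropic: `Σ εᵢ² = 0`. [folklore] -/
theorem chartT_X_sq_sum :
    chartT (X 0 : MvPolynomial (Fin 3) ℂ) ^ 2 + chartT (X 1 : MvPolynomial (Fin 3) ℂ) ^ 2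
      + chartT (X 2 : MvPolynomial (Fin 3) ℂ) ^ 2 = 0 := by
  have hI : Polynomial.C I * Polynomial.C I = (-1 : ℂ[X]) := by
    rw [← Polynomial.C_mul, I_mul_I, Polynomial.C_neg, Polynomial.C_1]
  simp only [chartT_X_zero, chartT_X_one, chartT_X_two]
  linear_combination (1 + Polynomial.X ^ 2) ^ 2 * hI

/-- **`chartT (r² · p) = 0`**: every multiple of `r² = x₀² + x₁² + x₂²` dies on the null cone. [folklore] -/
theorem chartT_normSq_mul (p : MvPolynomial (Fin 3) ℂ) :
    chartT ((X 0 ^ 2 + X 1 ^ 2 + X 2 ^ 2) * p) = 0 := by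
  rw [chartT_mul, chartT_add, chartT_add, chartT_pow, chartT_pow, chartT_pow, chartT_X_sq_sum, zero_mul]

/-- `chartT (r²^k · p) = 0` for `k ≥ 1`. [folklore] -/
theorem chartT_normSq_pow_mul (p : MvPolynomial (Fin 3) ℂ) {k : ℕ} (hk : 1 ≤ k) :
    chartT ((X 0 ^ 2 + X 1 ^ 2 + X 2 ^ 2) ^ k * p) = 0 := by
  obtain ⟨j, rfl⟩ := Nat.exists_eq_add_of_le' hk
  rw [pow_succ, mul_assoc, chartT_mul, chartT_normSq_mul, mul_zero]

/-! ### ★ The weighted Wronskian law -/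

/-- The velocity of the chart is a rotation of the chart: `ε × ε′ = 2i ε` (three components). [folklore] -/
theorem chartT_X_cross_derivative :
    chartT (X 1 : MvPolynomial (Fin 3) ℂ) * Polynomial.derivative (chartT (X 2 : MvPolynomial (Fin 3) ℂ))
        - chartT (X 2 : MvPolynomial (Fin 3) ℂ) * Polynomial.derivative (chartT (X 1 : MvPolynomial (Fin 3) ℂ))
        = Polynomial.C (2 * I) * chartT (X 0 : MvPolynomial (Fin 3) ℂ) ∧
    chartT (X 2 : MvPolynomial (Fin 3) ℂ) * Polynomial.derivative (chartT (X 0 : MvPolynomial (Fin 3) ℂ))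
        - chartT (X 0 : MvPolynomial (Fin 3) ℂ) * Polynomial.derivative (chartT (X 2 : MvPolynomial (Fin 3) ℂ))
        = Polynomial.C (2 * I) * chartT (X 1 : MvPolynomial (Fin 3) ℂ) ∧
    chartT (X 0 : MvPolynomial (Fin 3) ℂ) * Polynomial.derivative (chartT (X 1 : MvPolynomial (Fin 3) ℂ))
        - chartT (X 1 : MvPolynomial (Fin 3) ℂ) * Polynomial.derivative (chartT (X 0 : MvPolynomial (Fin 3) ℂ))
        = Polynomial.C (2 * I) * chartT (X 2 : MvPolynomial (Fin 3) ℂ) := by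
  have hI : Polynomial.C I * Polynomial.C I = (-1 : ℂ[X]) := by
    rw [← Polynomial.C_mul, I_mul_I, Polynomial.C_neg, Polynomial.C_1]
  rw [derivative_chartT_X_zero, derivative_chartT_X_one, derivative_chartT_X_two, chartT_X_zero, chartT_X_one,
    chartT_X_two]
  simp only [Polynomial.C_mul, Polynomial.C_ofNat]
  refine ⟨by ring, ?_, by ring⟩
  linear_combination (-(2 : ℂ[X]) * (1 + Polynomial.X ^ 2)) * hI

/-- Binet–Cauchy for two triples: `(A·ε)(B·ε′) − (A·ε′)(B·ε) = Σₖ (A × B)ₖ (ε × ε′)ₖ`. [folklore] -/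
theorem binetCauchy_fin3 (A B e f : Fin 3 → ℂ[X]) :
    (∑ i : Fin 3, A i * e i) * (∑ j : Fin 3, B j * f j) - (∑ i : Fin 3, A i * f i) * (∑ j : Fin 3, B j * e j)
      = (A 1 * B 2 - A 2 * B 1) * (e 1 * f 2 - e 2 * f 1) + (A 2 * B 0 - A 0 * B 2) * (e 2 * f 0 - e 0 * f 2)
        + (A 0 * B 1 - A 1 * B 0) * (e 0 * f 1 - e 1 * f 0) := by
  simp only [Fin.sum_univ_three]; ring

/-- ★ **THE WEIGHTED WRONSKIAN LAW.**  For homogeneous `a ∈ 𝓟_m`, `b ∈ 𝓟_n` on `ℂ³`, the chart of the loop bracket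
`det(∇a, ∇b, x)` is the weighted Wronskian of the charts:
`2i · chartT (detP a b) = m · chartT a · (chartT b)′ − n · (chartT a)′ · chartT b`.
(The loop bracket restricted to the null cone is the Jacobian of the two binary forms; de-homogenised, a Jacobian of forms of
degrees `2m`, `2n` is the weighted Wronskian.) [folklore] -/
theorem chartT_detP {a b : MvPolynomial (Fin 3) ℂ} {m n : ℕ} (ha : a.IsHomogeneous m) (hb : b.IsHomogeneous n) :
    Polynomial.C (2 * I) * chartT (detP a b)
      = (m : ℂ[X]) * chartT a * Polynomial.derivative (chartT b)
        - (n : ℂ[X]) * chartT b * Polynomial.derivative (chartT a) := by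
  obtain ⟨c0, c1, c2⟩ := chartT_X_cross_derivative
  have hA := chartT_euler ha
  have hB := chartT_euler hb
  set e : Fin 3 → ℂ[X] := fun j => chartT (X j : MvPolynomial (Fin 3) ℂ) with he
  set f : Fin 3 → ℂ[X] := fun j => Polynomial.derivative (chartT (X j : MvPolynomial (Fin 3) ℂ)) with hf
  rw [derivative_chartT a, derivative_chartT b, ← hA, ← hB]
  have key := binetCauchy_fin3 (fun j => chartT (pderiv j a)) (fun j => chartT (pderiv j b)) e f
  simp only [he, hf] at key
  rw [show (∑ j : Fin 3, chartT (pderiv j a) * chartT (X j)) * (∑ j : Fin 3, chartT (pderiv j b) * Polynomial.derivative (chartT (X j)))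
      - (∑ j : Fin 3, chartT (pderiv j b) * chartT (X j)) * (∑ j : Fin 3, chartT (pderiv j a) * Polynomial.derivative (chartT (X j)))
      = (∑ j : Fin 3, chartT (pderiv j a) * chartT (X j)) * (∑ j : Fin 3, chartT (pderiv j b) * Polynomial.derivative (chartT (X j)))
      - (∑ j : Fin 3, chartT (pderiv j a) * Polynomial.derivative (chartT (X j))) * (∑ j : Fin 3, chartT (pderiv j b) * chartT (X j))
      by ring, key, c0, c1, c2]
  simp only [detP, chartT_add, chartT_mul, chartT_sub]
  ring

/-! ### Degree of the chart; charts of linear forms -/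

/-- Each chart component has degree `≤ 2`. [folklore] -/
theorem natDegree_chartT_X_le (i : Fin 3) : (chartT (X i : MvPolynomial (Fin 3) ℂ)).natDegree ≤ 2 := by
  fin_cases i
  · simp only [Fin.zero_eta, chartT_X_zero]
    refine (Polynomial.natDegree_sub_le _ _).trans ?_
    simp
  · simp only [Fin.mk_one, chartT_X_one]
    refine (Polynomial.natDegree_C_mul_le _ _).trans ?_
    refine (Polynomial.natDegree_add_le _ _).trans ?_
    simp
  · simp only [Fin.reduceFinMk, chartT_X_two]
    calc (2 * Polynomial.X : ℂ[X]).natDegree ≤ (2 : ℂ[X]).natDegree + (Polynomial.X : ℂ[X]).natDegree :=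
          Polynomial.natDegree_mul_le
      _ ≤ 2 := by simp

/-- **The chart of a form of degree `n` has degree `≤ 2n`.** [folklore] -/
theorem natDegree_chartT_le {p : MvPolynomial (Fin 3) ℂ} {n : ℕ} (hp : p.IsHomogeneous n) :
    (chartT p).natDegree ≤ 2 * n := by
  classical
  have hX : ∀ i : Fin 3, (aeval ![(1 : Polynomial ℂ) - Polynomial.X ^ 2, Polynomial.C I * (1 + Polynomial.X ^ 2),
      2 * Polynomial.X] (X i : MvPolynomial (Fin 3) ℂ)).natDegree ≤ 2 := fun i => natDegree_chartT_X_le i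
  simp only [aeval_X] at hX
  rw [chartT_eq_aeval, MvPolynomial.aeval_def, MvPolynomial.eval₂_eq]
  refine Polynomial.natDegree_sum_le_of_forall_le _ _ fun d hd => ?_
  refine (Polynomial.natDegree_mul_le).trans ?_
  have hC : ((algebraMap ℂ ℂ[X]) (coeff d p)).natDegree = 0 := by
    rw [Polynomial.algebraMap_eq]; exact Polynomial.natDegree_C _
  rw [hC, zero_add]
  refine (Polynomial.natDegree_prod_le _ _).trans ?_
  have hdeg : ∑ i ∈ d.support, d i = n := (hp.degree_eq_sum_deg_support (by simpa using hd)).symm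
  calc ∑ i ∈ d.support, ((![(1 : Polynomial ℂ) - Polynomial.X ^ 2, Polynomial.C I * (1 + Polynomial.X ^ 2),
          2 * Polynomial.X] i) ^ d i).natDegree ≤ ∑ i ∈ d.support, 2 * d i := by
        refine Finset.sum_le_sum fun i _ => ?_
        refine (Polynomial.natDegree_pow_le).trans ?_
        rw [mul_comm]
        exact Nat.mul_le_mul_right _ (hX i)
    _ = 2 * n := by rw [← Finset.mul_sum, hdeg]

/-- A linear form `⟪a, x⟫ = a₀x₀ + a₁x₁ + a₂x₂` (`a ∈ ℂ³`) is homogeneous of degree one. [folklore] -/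
theorem isHomogeneous_lin (a : Fin 3 → ℂ) :
    (C (a 0) * X 0 + C (a 1) * X 1 + C (a 2) * X 2 : MvPolynomial (Fin 3) ℂ).IsHomogeneous 1 := by
  exact (((isHomogeneous_C _ _).mul (isHomogeneous_X _ _)).add ((isHomogeneous_C _ _).mul (isHomogeneous_X _ _))).add
    ((isHomogeneous_C _ _).mul (isHomogeneous_X _ _))

/-- **Chart of a linear form**: `chartT ⟪a,x⟫ = (a₀ + i a₁) + 2a₂ t + (i a₁ − a₀) t²`. [folklore] -/
theorem chartT_lin (a : Fin 3 → ℂ) :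
    chartT (C (a 0) * X 0 + C (a 1) * X 1 + C (a 2) * X 2)
      = Polynomial.C (a 0 + I * a 1) + Polynomial.C (2 * a 2) * Polynomial.X
        + Polynomial.C (I * a 1 - a 0) * Polynomial.X ^ 2 := by
  simp only [chartT_add, chartT_mul, chartT_C, chartT_X_zero, chartT_X_one, chartT_X_two,
    Polynomial.C_add, Polynomial.C_mul, Polynomial.C_sub]
  simp only [Polynomial.C_ofNat]
  ring

/-- **Every polynomial of degree `≤ 2` is the chart of a linear form.** [folklore] -/
theorem exists_lin_chartT_eq {q : ℂ[X]} (hq : q.natDegree ≤ 2) :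
    ∃ a : Fin 3 → ℂ, chartT (C (a 0) * X 0 + C (a 1) * X 1 + C (a 2) * X 2) = q := by
  -- `q = q₀ + q₁ t + q₂ t²`; take `a = ((q₀ − q₂)/2, −i(q₀ + q₂)/2, q₁/2)`
  refine ⟨![(q.coeff 0 - q.coeff 2) / 2, -I * (q.coeff 0 + q.coeff 2) / 2, q.coeff 1 / 2], ?_⟩
  rw [chartT_lin]
  have hq' : q = Polynomial.C (q.coeff 0) + Polynomial.C (q.coeff 1) * Polynomial.X
      + Polynomial.C (q.coeff 2) * Polynomial.X ^ 2 := by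
    conv_lhs => rw [Polynomial.as_sum_range_C_mul_X_pow' (p := q) (n := 3) (by omega)]
    simp [Finset.sum_range_succ]
  conv_rhs => rw [hq']
  simp only [Matrix.cons_val_zero, Matrix.cons_val_one, Matrix.cons_val]
  have e0 : (q.coeff 0 - q.coeff 2) / 2 + I * (-I * (q.coeff 0 + q.coeff 2) / 2) = q.coeff 0 := by
    have : I * I = -1 := I_mul_I
    linear_combination (-(q.coeff 0 + q.coeff 2) / 2) * this
  have e1 : 2 * (q.coeff 1 / 2) = q.coeff 1 := by ring
  have e2 : I * (-I * (q.coeff 0 + q.coeff 2) / 2) - (q.coeff 0 - q.coeff 2) / 2 = q.coeff 2 := by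
    have : I * I = -1 := I_mul_I
    linear_combination (-(q.coeff 0 + q.coeff 2) / 2) * this
  rw [e0, e1, e2]

/-- The chart of a linear form vanishes only for the zero form. [folklore] -/
theorem lin_eq_zero_of_chartT_eq_zero {a : Fin 3 → ℂ}
    (h : chartT (C (a 0) * X 0 + C (a 1) * X 1 + C (a 2) * X 2) = 0) : a = 0 := by
  rw [chartT_lin] at h
  have h0 := congrArg (fun q : ℂ[X] => q.coeff 0) h
  have h1 := congrArg (fun q : ℂ[X] => q.coeff 1) h
  have h2 := congrArg (fun q : ℂ[X] => q.coeff 2) h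
  simp only [Polynomial.coeff_add, Polynomial.coeff_C_zero, Polynomial.coeff_C_mul, Polynomial.coeff_X_zero,
    Polynomial.coeff_X_pow, Polynomial.coeff_zero, Polynomial.coeff_C_succ, Polynomial.coeff_X_one] at h0 h1 h2
  norm_num at h0 h1 h2
  have h2' : I * a 1 - a 0 = 0 := by simpa [h1] using h2
  have hI : I * I = -1 := I_mul_I
  have ha0 : a 0 = 0 := by linear_combination (h0 - h2') / 2
  have hs : I * a 1 = 0 := by linear_combination (h0 + h2') / 2
  have ha1 : a 1 = 0 := by linear_combination (-I) * hs + (a 1) * hI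
  funext i
  fin_cases i
  · exact ha0
  · exact ha1
  · simpa using h1

end Summit.NavierStokesRegularity.NavierStokesRegularity.Theorems.PoloidalLiouville.HorizonTower.Zonal

end
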